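import Mathlib
import HarnessLib
import Summits.SmoothPoincare4.Statement
import Literature.Geometry.Kaehler.ManifoldForms
import Literature.Geometry.Symplectic.GromovR4RelEnd
import Literature.Topology.FourManifolds.CerfGammaFour
import Summits.SmoothPoincare4.SmoothPoincare4.Theses.SymplecticOrigami

/-!
# Sketch (crux-ideate round 1, ideator 3) — first lemmas for crux `OrigamiRung`
(item stmt-SmoothPoincare4-7843, route SymplecticOrigami).

Three levers, one first lemma each, plus the kernel-checked composition showing that
`SieveDichotomy` and `GenusZeroRung` together give the crux BY NAME (conditionally on the two
tree named facts `gromov_recognitionR4_relEnd`, `cerf_twistedSphere_four`).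

* `FoldData` bundles the hypotheses of `OrigamiRung` verbatim (global clause ∧ per-piece clause).
* Card `adjunction-doubling-sieve`: `HantzscheDoubling`, `SieveDichotomy`, `sieve_arith` (proved).
* Card `cap-swap-gromov-end`: `GenusZeroRung`.
* Card `corank-one-collar`: `CollarBDF`.
-/

open scoped Manifold ContDiff Topology ContinuousMap
open Set TopologicalSpace

namespace Summit.SmoothPoincare4.SmoothPoincare4.Cruxes.OrigamiRung.SketchIdeator3

/-- Model space `ℝⁿ`. -/
local notation "𝔼" n:arg => EuclideanSpace ℝ (Fin n)
/-- The round 4-sphere. -/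
local notation "𝕊⁴" => (Metric.sphere (0 : EuclideanSpace ℝ (Fin 5)) 1)
/-- The round 2-sphere. -/
local notation "𝕊²" => (Metric.sphere (0 : EuclideanSpace ℝ (Fin 3)) 1)

open Literature.Topology.FourManifolds (singularHomologyZ)

/-- The fold data of `OrigamiRung` (its two hypothesis clauses, verbatim, as one predicate). -/
def FoldData (M : Type) [TopologicalSpace M] [ChartedSpace (𝔼 4) M]
    (V : Fin 2 → Opens M) (N : Fin 2 → Type) [∀ i, TopologicalSpace (N i)]
    [∀ i, ChartedSpace (𝔼 4) (N i)]
    (s : ∀ i, Literature.Geometry.Kaehler.MForm (𝓡 4) (N i) ℝ 2) (S : Fin 2 → Type)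
    [∀ i, TopologicalSpace (S i)] [∀ i, ChartedSpace (𝔼 2) (S i)]
    (b : ∀ i, S i → N i) (β : ∀ i, M → N i) : Prop :=
  (Disjoint (V 0) (V 1) ∧ (∀ i, (V i : Set M).Nonempty) ∧
      IsConnected ((V 0 : Set M) ∪ (V 1 : Set M))ᶜ ∧
      (∃ (Z : Type) (_ : TopologicalSpace Z) (_ : ChartedSpace (𝔼 3) Z) (_ : IsManifold (𝓡 3) ∞ Z)
        (z : Z → M), Manifold.IsSmoothEmbedding (𝓡 3) (𝓡 4) ∞ z ∧
          Set.range z = ((V 0 : Set M) ∪ (V 1 : Set M))ᶜ)) ∧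
  (∀ i, Literature.Geometry.Kaehler.IsSmoothForm (s i) ∧ Literature.Geometry.Kaehler.IsClosedForm (s i) ∧
    (∀ x (v : TangentSpace (𝓡 4) x), v ≠ 0 → ∃ w, s i x ![v, w] ≠ 0) ∧
    Manifold.IsSmoothEmbedding (𝓡 2) (𝓡 4) ∞ (b i) ∧
    (∀ y (v : TangentSpace (𝓡 2) y), v ≠ 0 → ∃ w : TangentSpace (𝓡 2) y,
      s i (b i y) ![mfderiv (𝓡 2) (𝓡 4) (b i) y v, mfderiv (𝓡 2) (𝓡 4) (b i) y w] ≠ 0) ∧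
    (∃ U : Set M, IsOpen U ∧ closure (V i : Set M) ⊆ U ∧ ContMDiffOn (𝓡 4) (𝓡 4) ∞ (β i) U) ∧
    Set.InjOn (β i) (V i : Set M) ∧ β i '' (V i : Set M) = (Set.range (b i))ᶜ ∧
    (∀ x ∈ (V i : Set M), Function.Bijective (mfderiv (𝓡 4) (𝓡 4) (β i) x)) ∧
    β i '' frontier (V i : Set M) ⊆ Set.range (b i) ∧
    (∀ x ∈ frontier (V i : Set M),
      Module.finrank ℝ (LinearMap.ker (mfderiv (𝓡 4) (𝓡 4) (β i) x).toLinearMap) = 1))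

/-! ## Card `adjunction-doubling-sieve` -/

/-- **Hantzsche doubling** (first lemma, general form): a closed connected 3-manifold `Z`
smoothly embedded in a homotopy 4-sphere `M` as the common frontier of two disjoint non-empty open
sets has `Tors H₁(Z; ℤ) ≅ T ⊕ T` (Alexander duality in the homology sphere `M` + Mayer–Vietoris:
`T = Tors H₁` of either closed complementary piece). Hantzsche 1938; Kawauchi's survey. -/
def HantzscheDoubling : Prop :=
  ∀ (M : Type) [TopologicalSpace M] [T2Space M] [SecondCountableTopology M]
    [ChartedSpace (𝔼 4) M] [IsManifold (𝓡 4) ∞ M],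
    M ≃ₕ 𝕊⁴ →
    ∀ (V : Fin 2 → Opens M) (Z : Type) [TopologicalSpace Z] [ChartedSpace (𝔼 3) Z]
      [IsManifold (𝓡 3) ∞ Z] (z : Z → M),
      Disjoint (V 0) (V 1) → (∀ i, (V i : Set M).Nonempty) →
      IsConnected ((V 0 : Set M) ∪ (V 1 : Set M))ᶜ →
      Manifold.IsSmoothEmbedding (𝓡 3) (𝓡 4) ∞ z →
      Set.range z = ((V 0 : Set M) ∪ (V 1 : Set M))ᶜ →
      ∃ (T : Type) (_ : AddCommGroup T) (_ : Finite T),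
        Nonempty (AddCommGroup.torsion (singularHomologyZ Z 1) ≃+ T × T)

/-- **Sieve dichotomy** (the lever's output, over the crux binders): for fold data on a homotopy
4-sphere, EITHER both collapsed folds are spheres and both pieces have `(b₁, b₂) = (0, 1)` (genus
`0`, `e = 1`: `(Nᵢ, Bᵢ)` a homology `(ℂP², line)`), OR both folds have genus `2` and both pieces are
doors `(b₁, b₂) = (2, 1)`. Proof plan: collar lemma; Mayer–Vietoris/Alexander duality pinch
`b₂(Nᵢ) = 1`, `b₁(N₀)+b₁(N₁) = 2g`, `e ≠ 0`; Hantzsche doubling `ℤ/e ≅ T ⊕ T ⇒ e = 1`;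
adjunction + `c₁² = 2χ + 3σ` on the rank-one lattice ⇒ `b₁(Nᵢ) = g(3-g)`; `sieve_arith`. -/
def SieveDichotomy : Prop :=
  ∀ (M : Type) [TopologicalSpace M] [T2Space M] [SecondCountableTopology M]
    [ChartedSpace (𝔼 4) M] [IsManifold (𝓡 4) ∞ M],
    M ≃ₕ 𝕊⁴ →
    ∀ (V : Fin 2 → Opens M) (N : Fin 2 → Type) [∀ i, TopologicalSpace (N i)]
      [∀ i, T2Space (N i)] [∀ i, SecondCountableTopology (N i)] [∀ i, CompactSpace (N i)]
      [∀ i, ConnectedSpace (N i)] [∀ i, ChartedSpace (𝔼 4) (N i)] [∀ i, IsManifold (𝓡 4) ∞ (N i)]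
      (s : ∀ i, Literature.Geometry.Kaehler.MForm (𝓡 4) (N i) ℝ 2) (S : Fin 2 → Type)
      [∀ i, TopologicalSpace (S i)] [∀ i, CompactSpace (S i)] [∀ i, ConnectedSpace (S i)]
      [∀ i, ChartedSpace (𝔼 2) (S i)] [∀ i, IsManifold (𝓡 2) ∞ (S i)]
      (b : ∀ i, S i → N i) (β : ∀ i, M → N i),
      FoldData M V N s S b β →
        (∀ i, Nonempty (S i ≃ₘ⟮𝓡 2, 𝓡 2⟯ 𝕊²) ∧
            Module.finrank ℤ (singularHomologyZ (N i) 1) = 0 ∧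
            Module.finrank ℤ (singularHomologyZ (N i) 2) = 1) ∨
        (∀ i, Module.finrank ℤ (singularHomologyZ (S i) 1) = 4 ∧
            Module.finrank ℤ (singularHomologyZ (N i) 1) = 2 ∧
            Module.finrank ℤ (singularHomologyZ (N i) 2) = 1)

/-- **The arithmetic core of the sieve** (proved): with `e = 1`, adjunction gives
`c₁·B = 3 - 2g`, and `c₁² = 9 - 4b₁` on each piece; the pinch gives `b₁(N₀) + b₁(N₁) = 2g`.
Only `g = 0` (both `b₁ = 0`) and `g = 2` (both `b₁ = 2`) survive. -/
theorem sieve_arith (g b₀ b₁ : ℤ) (h₀ : (3 - 2 * g) ^ 2 = 9 - 4 * b₀)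
    (h₁ : (3 - 2 * g) ^ 2 = 9 - 4 * b₁) (hsum : b₀ + b₁ = 2 * g) :
    (g = 0 ∧ b₀ = 0 ∧ b₁ = 0) ∨ (g = 2 ∧ b₀ = 2 ∧ b₁ = 2) := by
  have hb₀ : b₀ = 3 * g - g ^ 2 := by nlinarith
  have hb₁ : b₁ = 3 * g - g ^ 2 := by nlinarith
  have hg : g * (2 - g) = 0 := by nlinarith
  rcases mul_eq_zero.mp hg with h | h
  · left; subst h; simp_all
  · have : g = 2 := by linarith
    right; subst this; norm_num at hb₀ hb₁; exact ⟨rfl, hb₀, hb₁⟩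

/-! ## Card `cap-swap-gromov-end` -/

/-- **Genus-zero rung by cap swap** (first lemma): if both collapsed folds are spheres, then
`M ≅ S⁴` — conditionally on the tree's named facts `gromov_recognitionR4_relEnd` (Gromov's
recognition of `(ℝ⁴, ω₀)` relative at infinity = crux `GromovRecognitionRelEnd` of route
SymplecticCap) and `cerf_twistedSphere_four` (`Γ₄ = 0`). Proof plan: collar lemma ⇒
`V̄ᵢ ≅ Xᵢ = Nᵢ ∖ νBᵢ`; sieve ⇒ `Bᵢ² = 1`, `Xᵢ` contractible; Weinstein neighbourhood +
`ℂP² ∖ line ≅ ball` ⇒ the punctured neighbourhood of `Bᵢ` in `Vᵢ` is a standard shell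
`{R₁ < ‖z‖ < R₀} ⊂ (ℝ⁴, ω₀)`; glue `{‖z‖ > R₁}` along it ⇒ `V̂ᵢ` symplectic, standard at infinity,
`π₂ = 0`; Gromov ⇒ `V̂ᵢ ≅ ℝ⁴` rel end ⇒ `Xᵢ ≅ D⁴`; `M = D⁴ ∪_φ D⁴`; Cerf. -/
def GenusZeroRung : Prop :=
  Literature.Geometry.Symplectic.gromov_recognitionR4_relEnd →
  Literature.Topology.FourManifolds.cerf_twistedSphere_four →
  ∀ (M : Type) [TopologicalSpace M] [T2Space M] [SecondCountableTopology M]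
    [ChartedSpace (𝔼 4) M] [IsManifold (𝓡 4) ∞ M],
    M ≃ₕ 𝕊⁴ →
    ∀ (V : Fin 2 → Opens M) (N : Fin 2 → Type) [∀ i, TopologicalSpace (N i)]
      [∀ i, T2Space (N i)] [∀ i, SecondCountableTopology (N i)] [∀ i, CompactSpace (N i)]
      [∀ i, ConnectedSpace (N i)] [∀ i, ChartedSpace (𝔼 4) (N i)] [∀ i, IsManifold (𝓡 4) ∞ (N i)]
      (s : ∀ i, Literature.Geometry.Kaehler.MForm (𝓡 4) (N i) ℝ 2) (S : Fin 2 → Type)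
      [∀ i, TopologicalSpace (S i)] [∀ i, CompactSpace (S i)] [∀ i, ConnectedSpace (S i)]
      [∀ i, ChartedSpace (𝔼 2) (S i)] [∀ i, IsManifold (𝓡 2) ∞ (S i)]
      (b : ∀ i, S i → N i) (β : ∀ i, M → N i),
      FoldData M V N s S b β →
      (∀ i, Nonempty (S i ≃ₘ⟮𝓡 2, 𝓡 2⟯ 𝕊²)) →
      Nonempty (M ≃ₘ⟮𝓡 4, 𝓡 4⟯ 𝕊⁴)

/-! ## Card `corank-one-collar` -/

/-- **Collar from corank one** (first lemma): for each piece, (a) the frontier of `Vᵢ` is the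
whole fold `Z`; (b) the fibres of `βᵢ|_Z : Z → Bᵢ` are connected (single circles); (c) there is a
boundary-defining function `ρ` for `Z ⊂ V̄ᵢ` — smooth near `Z`, `= 0` with non-zero differential
on `Z`, `> 0` without critical points on `Vᵢ` near `Z` (it is `ρ = r ∘ βᵢ`, `r` the fibre norm of
a tubular neighbourhood of `Bᵢ`; Hadamard factorisation `w ∘ βᵢ = t·u`, `u ≠ 0` on `Z`, from
`rank dβᵢ = 3` and `βᵢ(Z) ⊆ Bᵢ`). Consequence (not spelled here): `V̄ᵢ ≅ Nᵢ ∖ ν_δ Bᵢ` via `βᵢ`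
and `Z ≅ S(νBᵢ)`. -/
def CollarBDF : Prop :=
  ∀ (M : Type) [TopologicalSpace M] [T2Space M] [SecondCountableTopology M]
    [ChartedSpace (𝔼 4) M] [IsManifold (𝓡 4) ∞ M],
    M ≃ₕ 𝕊⁴ →
    ∀ (V : Fin 2 → Opens M) (N : Fin 2 → Type) [∀ i, TopologicalSpace (N i)]
      [∀ i, T2Space (N i)] [∀ i, SecondCountableTopology (N i)] [∀ i, CompactSpace (N i)]
      [∀ i, ConnectedSpace (N i)] [∀ i, ChartedSpace (𝔼 4) (N i)] [∀ i, IsManifold (𝓡 4) ∞ (N i)]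
      (s : ∀ i, Literature.Geometry.Kaehler.MForm (𝓡 4) (N i) ℝ 2) (S : Fin 2 → Type)
      [∀ i, TopologicalSpace (S i)] [∀ i, CompactSpace (S i)] [∀ i, ConnectedSpace (S i)]
      [∀ i, ChartedSpace (𝔼 2) (S i)] [∀ i, IsManifold (𝓡 2) ∞ (S i)]
      (b : ∀ i, S i → N i) (β : ∀ i, M → N i),
      FoldData M V N s S b β →
      ∀ i, frontier (V i : Set M) = ((V 0 : Set M) ∪ (V 1 : Set M))ᶜ ∧
        (∀ p ∈ Set.range (b i), IsConnected (β i ⁻¹' {p} ∩ frontier (V i : Set M))) ∧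
        ∃ (W : Set M) (ρ : M → ℝ), IsOpen W ∧ frontier (V i : Set M) ⊆ W ∧
          ContMDiffOn (𝓡 4) 𝓘(ℝ, ℝ) ∞ ρ W ∧
          (∀ x ∈ frontier (V i : Set M), ρ x = 0 ∧ mfderiv (𝓡 4) 𝓘(ℝ, ℝ) ρ x ≠ 0) ∧
          (∀ x ∈ (V i : Set M) ∩ W, 0 < ρ x ∧ mfderiv (𝓡 4) 𝓘(ℝ, ℝ) ρ x ≠ 0)

/-! ## Composition: the two levers give the crux by name -/

/-- `SieveDichotomy` + `GenusZeroRung` (+ the two tree facts) ⇒ `OrigamiRung`, literally. -/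
theorem OrigamiRung_of (hS : SieveDichotomy) (hZ : GenusZeroRung)
    (hG : Literature.Geometry.Symplectic.gromov_recognitionR4_relEnd)
    (hC : Literature.Topology.FourManifolds.cerf_twistedSphere_four) :
    Summit.SmoothPoincare4.SmoothPoincare4.Theses.SymplecticOrigami.OrigamiRung := by
  intro M _ _ _ _ _ e V N _ _ _ _ _ _ _ s S _ _ _ _ _ b β hdata hprops
  have hF : FoldData M V N s S b β := ⟨hdata, hprops⟩
  rcases hS M e V N s S b β hF with h | h
  · exact Or.inl (hZ hG hC M e V N s S b β hF (fun i => (h i).1))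
  · exact Or.inr (fun i => ⟨(h i).2.1, (h i).2.2⟩)

end Summit.SmoothPoincare4.SmoothPoincare4.Cruxes.OrigamiRung.SketchIdeator3
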